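import Literature.Probability.LatticeModels.FKIsingWiredRectDuality
import HarnessLib

/-!
# DCS Lemma 6.3 from DCS Theorem 3.16: the conditional reduction, completed

Topic `Literature/Probability/LatticeModels` (trunk `StatMech`, family `crit-ising`). Last
instalment of the proved part of Duminil-Copin–Smirnov 2012, Lemma 6.3
(`fkIsing_annulusCrossing_le`), after `FKIsingAnnulusCrossingProofs.lean`,
`FKIsingAnnulusTopRect.lean` and `FKIsingWiredRectDuality.lean`. The latter bounds the wired top
rectangle by `1 - φ⁰_{⟨Ê⟩}(open left-right crossing of X)`, the free critical FK-Ising measure of a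
spanning graph of the primal box `P_{2n}` containing every edge of `R_T^∘ = [-2n+1, 2n] × [n+1, 2n]`,
and `X = [-2n+1, 2n] × [n+1, 2n-1-j]` a `(4n-1) × (n-2-j)` rectangle. Here the right-hand side
is bounded below by DCS **Thm. 3.16** (`fkIsing_rsw`, the RSW bound of Duminil-Copin–Hongler–Nolin
for `4m × m` rectangles with *free* boundary conditions, a named fact of `FKIsingRSW.lean`, taken as
a hypothesis), which yields the **conditional reduction**

  `fkIsing_annulusCrossing_le_of_fkIsing_rsw : fkIsing_rsw → fkIsing_annulusCrossing_le`.

The width `4n - 1` of `X` is never of the form `4m`, so Thm. 3.16 is combined with the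
Russo–Seymour–Welsh gluing of crossings (Bollobás–Riordan 2006, Ch. 3, eq. (2); the tree's
`lrCrossing_of_glue`), under the free measure `φ⁰_{⟨Ê⟩}` and its FKG inequality
(`rcMeasure_fkg_holds`): with the margin `j(n) = (n-2) mod 4`, the height `N = n-2-j(n)` of `X` is a
multiple of `4`, `N = 4K`, and for `n ≥ 12`

* the left `4N × N` block `Q₁` of `X` is crossed horizontally with probability `≥ c`
  (`fkIsing_rsw.shift`), and so is the right-aligned `4N × N` block `Q₂⁺` of `X`, hence its right
  part `Q₂` of width `4n-1-3N ≥ N` (`lrCrossingAt_of_right_aligned`);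
* the `K × 4K` block `Y` standing on the bottom row of `X` at the left end of the overlap square
  `S = Q₁ ∩ Q₂` is crossed vertically with probability `≥ c'` (`fkIsing_rsw.transpose_shift`),
  which crosses `S` vertically;
* each of these probabilities under the free measure of the block is at most the probability
  under `φ⁰_{⟨Ê⟩}` (free measures increase with the domain: `rcMeasure_fromEdgeSet_real_le`, with
  the identification of the block's own measure `rcMeasure_real_map_image`;
  `real_openCrossing_le_free_dualTopRectEdges`);
* the three events glue to the long crossing of `X` (`lrCrossingAt_of_glue`, a translate of
  `lrCrossing_of_glue`), so `φ⁰_{⟨Ê⟩}(LR(X)) ≥ c · c' · c` by FKG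
  (`real_primalLongCrossing_ge`).

With `fkIsing_annulusCrossing_le_of_topRect` and `real_topRectCrossing_le_one_sub_free` this proves
`fkIsing_annulusCrossing_le` from `fkIsing_rsw`, with the constant
`max (1 - (c · c' · c)⁴) (max_{1 ≤ n < 12} φ(annulus crossing))` (`fkIsing_annulusCrossing_le_of_fkIsing_rsw`).
Everything here is proved; the only remaining hypothesis is the named fact `fkIsing_rsw`
(DCS Thm. 3.16), which is not restated (D-0026).

## References

* H. Duminil-Copin, S. Smirnov, *Conformal invariance of lattice models*, Clay Math. Proc. 15
  (2012) 213–276, arXiv:1109.1549: Thm. 3.16, Lemma 6.3 and its proof (p. 27).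
* B. Bollobás, O. Riordan, *Percolation*, CUP (2006), Ch. 3, eq. (2) and Fig. 7 (gluing).
* G. Grimmett, *The Random-Cluster Model*, Springer (2006): Thm. 3.8 (FKG), Thm. 3.1(a).
-/

noncomputable section

open MeasureTheory
open Literature.Probability.LatticeModels Literature.Probability.Percolation
open Literature.Barriers.CriticalPhenomena

namespace Literature.Probability.LatticeModels

/-! ### Crossings of translated rectangles: gluing and right-aligned sub-rectangles -/

section SiteLevel

open SimpleGraph

/-- Undoing a translation of translated sets: `(· - v)((· + (v + g))(S)) = (· + g)(S)`. [folklore] -/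
theorem image_zdShiftIso_neg_image_add_add (v g : Site 2) (S : Set (Site 2)) :
    (zdShiftIso (-v)) '' ((· + (v + g)) '' S) = (· + g) '' S := by
  rw [Set.image_image]
  refine Set.image_congr' fun x ↦ ?_
  rw [zdShiftIso_apply]
  abel

/-- **Gluing horizontal crossings at any position** (Bollobás–Riordan 2006, Ch. 3, eq. (2),
Fig. 7; the tree's `lrCrossing_of_glue` translated by `v`): if `v + [0, m₁] × [0, N]` and
`v + g + [0, m₂] × [0, N]` (`g = (m₁ - N, 0)`) have open left-right crossings and the square
`v + g + [0, N]²` has an open vertical crossing, then `v + [0, m₁ + m₂ - N] × [0, N]` has an open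
left-right crossing. [cite: BollobasRiordan2006, Ch. 3, eq. (2)] -/
theorem lrCrossingAt_of_glue {m₁ m₂ N : ℕ} (hN₁ : N ≤ m₁) (hN₂ : N ≤ m₂) (v : Site 2)
    {ω : BondConfig (Site 2)} (hω : ω ⊆ (zdGraph 2).edgeSet)
    (h₁ : ω ∈ openCrossing ((· + v) '' (↑(rectangle m₁ N) : Set (Site 2))) ((· + v) '' ↑(leftSide m₁ N))
      ((· + v) '' ↑(rightSide m₁ N)))
    (hV : ω ∈ openCrossing ((· + (v + glueShift m₁ N)) '' (↑(rectangle N N) : Set (Site 2)))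
      ((· + (v + glueShift m₁ N)) '' ↑(bottomSide N N)) ((· + (v + glueShift m₁ N)) '' ↑(topSide N N)))
    (h₂ : ω ∈ openCrossing ((· + (v + glueShift m₁ N)) '' (↑(rectangle m₂ N) : Set (Site 2)))
      ((· + (v + glueShift m₁ N)) '' ↑(leftSide m₂ N)) ((· + (v + glueShift m₁ N)) '' ↑(rightSide m₂ N))) :
    ω ∈ openCrossing ((· + v) '' (↑(rectangle (m₁ + m₂ - N) N) : Set (Site 2)))
      ((· + v) '' ↑(leftSide (m₁ + m₂ - N) N)) ((· + v) '' ↑(rightSide (m₁ + m₂ - N) N)) := by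
  set φ := (zdShiftIso (-v)).toEquiv with hφ
  have hcoe : ((zdShiftIso (-v)).toEquiv : Site 2 → Site 2) = zdShiftIso (-v) := rfl
  have hω' : BondConfig.relabel (sym2Equiv φ) ω ⊆ (zdGraph 2).edgeSet := by
    intro d hd
    rw [BondConfig.mem_relabel_iff] at hd
    have := hω hd
    rwa [sym2Equiv_symm, show φ.symm = (zdShiftIso (-v)).symm.toEquiv from rfl,
      sym2Equiv_mem_edgeSet_iff] at this
  have h₁' := relabel_mem_openCrossing φ h₁
  have hV' := relabel_mem_openCrossing φ hV
  have h₂' := relabel_mem_openCrossing φ h₂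
  rw [hcoe, image_zdShiftIso_neg_image_add, image_zdShiftIso_neg_image_add,
    image_zdShiftIso_neg_image_add] at h₁'
  rw [hcoe, image_zdShiftIso_neg_image_add_add, image_zdShiftIso_neg_image_add_add,
    image_zdShiftIso_neg_image_add_add] at hV' h₂'
  have key := lrCrossing_of_glue hN₁ hN₂ hω' h₁' hV' h₂'
  -- pull back along the translation
  have back := relabel_mem_openCrossing φ.symm key
  rw [relabel_symm_relabel] at back
  have hsymm : (φ.symm : Site 2 → Site 2) = (· + v) := by
    funext x
    change (zdShiftIso (-v)).symm x = x + v
    rw [zdShiftIso_symm_apply, sub_neg_eq_add]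
  rwa [hsymm] at back

/-- **A horizontal crossing crosses every right-aligned sub-rectangle** (stop the crossing at
its last visit to the column `{x₀ = a}`, `exists_openConnIn_column_ge`): an open left-right
crossing of `v + [0, M] × [0, N]` gives one of `(a, v₁) + [0, v₀ + M - a] × [0, N]` for
`v₀ ≤ a ≤ v₀ + M`. [cite: BollobasRiordan2006, Ch. 3, proof of eq. (3)] -/
theorem lrCrossingAt_of_right_aligned {M N M' : ℕ} (v : Site 2) (a : ℤ) (ha : v 0 ≤ a)
    (hM' : a + M' = v 0 + M) {ω : BondConfig (Site 2)} (hω : ω ⊆ (zdGraph 2).edgeSet)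
    (h : ω ∈ openCrossing ((· + v) '' (↑(rectangle M N) : Set (Site 2))) ((· + v) '' ↑(leftSide M N))
      ((· + v) '' ↑(rightSide M N))) :
    ω ∈ openCrossing ((· + ![a, v 1]) '' (↑(rectangle M' N) : Set (Site 2)))
      ((· + ![a, v 1]) '' ↑(leftSide M' N)) ((· + ![a, v 1]) '' ↑(rightSide M' N)) := by
  obtain ⟨x, hx, y, hy, hxy⟩ := h
  rw [mem_image_add_leftSide] at hx
  rw [mem_image_add_rightSide] at hy
  have hyx : ω ∈ openConnIn ((· + v) '' ↑(rectangle M N)) y x := by rw [openConnIn_comm]; exact hxy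
  obtain ⟨z, hz0, hyz⟩ := exists_openConnIn_column_ge hω a (by rw [hy.2]; omega) (by rw [hx.2]; omega) hyx
  have hsub : ((· + v) '' (↑(rectangle M N) : Set (Site 2)) ∩ {z : Site 2 | a ≤ z 0}) ⊆
      (· + ![a, v 1]) '' (↑(rectangle M' N) : Set (Site 2)) := by
    intro w hw
    rw [Set.mem_inter_iff, mem_image_add_rectangle, Set.mem_setOf_eq] at hw
    rw [mem_image_add_rectangle]
    simp only [Matrix.cons_val_zero, Matrix.cons_val_one]
    omega
  have hzS : z ∈ (· + v) '' (↑(rectangle M N) : Set (Site 2)) ∩ {z : Site 2 | a ≤ z 0} := hyz.2.1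
  rw [Set.mem_inter_iff, mem_image_add_rectangle] at hzS
  refine ⟨z, ?_, y, ?_, ?_⟩
  · rw [mem_image_add_leftSide]
    simp only [Matrix.cons_val_zero, Matrix.cons_val_one]
    omega
  · rw [mem_image_add_rightSide]
    simp only [Matrix.cons_val_zero, Matrix.cons_val_one]
    omega
  · rw [openConnIn_comm]
    exact openConnIn_mono hsub _ _ hyz

end SiteLevel

/-! ### Rectangles at a position, as finite vertex sets -/

section RectAt

/-- The lattice rectangle `v + [0, a] × [0, b]`. [folklore] -/
def rectAt (v : Site 2) (a b : ℕ) : Finset (Site 2) := Finset.Icc v (v + ![(a : ℤ), b])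

/-- Membership in `rectAt v a b`. [folklore] -/
theorem mem_rectAt_iff {v x : Site 2} {a b : ℕ} :
    x ∈ rectAt v a b ↔ v 0 ≤ x 0 ∧ x 0 ≤ v 0 + a ∧ v 1 ≤ x 1 ∧ x 1 ≤ v 1 + b := by
  simp only [rectAt, Finset.mem_Icc, Pi.le_def, Fin.forall_fin_two, Pi.add_apply,
    Matrix.cons_val_zero, Matrix.cons_val_one]
  tauto

/-- `rectAt v a b` is the translate by `v` of `rectangle a b` (the form used by
`fkIsing_rsw.shift`). [folklore] -/
theorem mem_rectAt_iff_sub_mem {v x : Site 2} {a b : ℕ} : x ∈ rectAt v a b ↔ x - v ∈ rectangle a b := by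
  rw [mem_rectAt_iff, mem_rectangle_iff]
  simp only [Pi.sub_apply]
  omega

/-- `rectAt v a b`, for `fkIsing_rsw.transpose_shift`: membership through the transposed
difference. [folklore] -/
theorem mem_rectAt_iff_transpose_mem {v x : Site 2} {a b : ℕ} :
    x ∈ rectAt v a b ↔ (![x 1 - v 1, x 0 - v 0] : Site 2) ∈ rectangle b a := by
  rw [mem_rectAt_iff, mem_rectangle_iff]
  simp only [Matrix.cons_val_zero, Matrix.cons_val_one]
  omega

end RectAt

/-! ### The free measure of `⟨Ê⟩` dominates the free measure of every block inside `R_T^∘` -/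

section FreeDomination

open SimpleGraph Finset

/-- **An event containing the empty configuration has positive probability** (the empty
configuration has mass `(1-p)^{|E|} q^{k(∅)} / Z > 0` for `p < 1`).
[cite: Grimmett2006, §1.2 eq. (1.2)] -/
theorem rcMeasure_real_pos_of_empty_mem {V : Type*} [Fintype V] [DecidableEq V]
    (G : SimpleGraph V) [DecidableRel G.Adj] {p q : ℝ} (hp : p ∈ Set.Icc (0 : ℝ) 1)
    (hp1 : p < 1) (hq : 0 < q) (B : Set V) {A : Set (BondConfig V)}
    (hA : (∅ : BondConfig V) ∈ A) : 0 < (rcMeasure G p q B).real A := by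
  classical
  haveI := isProbabilityMeasure_rcMeasure G hp hq B
  have hZ := rcPartitionFunction_pos G hp hq B
  have hempty : (rcMeasure G p q B).real {(∅ : BondConfig V)} =
      rcWeight G p q B ∅ / rcPartitionFunction G p q B := by
    rw [rcMeasure_real_apply G hp hq B]
    rw [Finset.sum_eq_single_of_mem ∅ (Finset.empty_mem_powerset _) fun ω _ hω ↦ ?_]
    · simp
    · rw [if_neg]
      rw [Set.mem_singleton_iff, Finset.coe_eq_empty]
      exact hω
  have hpos : 0 < (rcMeasure G p q B).real {(∅ : BondConfig V)} := by
    rw [hempty]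
    refine div_pos ?_ hZ
    unfold rcWeight
    have : 0 < 1 - p := sub_pos.2 hp1
    rw [Finset.card_empty, pow_zero, one_mul]
    positivity
  exact hpos.trans_le (measureReal_mono (Set.singleton_subset_iff.2 hA) (measure_ne_top _ _))

/-- The edges of a block inside `R_T^∘ = [-2n+1, 2n] × [n+1, 2n]` belong to `Ê`. [folklore] -/
theorem insideEdges_subset_dualTopRectEdges {n : ℕ} {S : Finset (Site 2)} (hS : S ⊆ pbox (2 * n))
    (hR : ∀ x ∈ S, -(2 * n : ℤ) + 1 ≤ x 0 ∧ x 0 ≤ 2 * n ∧ (n : ℤ) + 1 ≤ x 1 ∧ x 1 ≤ 2 * n) :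
    insideEdges (zdGraph 2) hS ⊆ dualTopRectEdges n := by
  intro e he
  have heE : e ∈ (pboxGraph (2 * n)).edgeFinset := by
    have := insideEdges_subset_edgeFinset hS he
    rw [mem_edgeFinset] at this ⊢
    exact this
  refine mem_dualTopRectEdges_of_mem heE ?_
  obtain ⟨e', -, rfl⟩ := Finset.mem_map.1 he
  induction e' using Sym2.ind with
  | h a b =>
    intro x hx
    rw [edgeLift_mk] at hx
    rcases Sym2.mem_iff.1 hx with rfl | rfl
    · rw [finsetIncl_coe]; exact hR _ a.2
    · rw [finsetIncl_coe]; exact hR _ b.2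

/-- **Free measures increase with the domain, from a block to `⟨Ê⟩`** (Grimmett 2006, Thm. 3.1(a)
and positive association; the tree's `rcMeasure_fromEdgeSet_real_le` combined with the
identification `rcMeasure_real_map_image` of the block's own measure): for a block `S` inside
`R_T^∘`, an open crossing event of `S` under the free critical FK-Ising measure of `S` is at most as
likely as the same event, read on the primal box, under the free measure of `⟨Ê⟩`.
[cite: Grimmett2006, Thm. (3.1)(a) and Lemma (4.14)] -/
theorem real_openCrossing_le_free_dualTopRectEdges {n : ℕ} {S : Finset (Site 2)}
    (hS : S ⊆ pbox (2 * n))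
    (hR : ∀ x ∈ S, -(2 * n : ℤ) + 1 ≤ x 0 ∧ x 0 ≤ 2 * n ∧ (n : ℤ) + 1 ≤ x 1 ∧ x 1 ≤ 2 * n)
    (T A B : Set ↥(S : Set (Site 2))) :
    (fkIsingFiniteMeasure S ∅).real (openCrossing T A B) ≤
      (rcMeasure (fromEdgeSet (↑(dualTopRectEdges n) : Set (Sym2 (PBoxV (2 * n)))))
          criticalFKIsingParam 2 ∅).real
        (openCrossing (finsetInclEmb hS '' T) (finsetInclEmb hS '' A) (finsetInclEmb hS '' B)) := by
  have hp := criticalFKIsingParam_mem_Icc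
  set U : Finset (Sym2 (PBoxV (2 * n))) := insideEdges (zdGraph 2) hS with hU
  have hUE : U ⊆ (finsetGraph (zdGraph 2) (pbox (2 * n))).edgeFinset := insideEdges_subset_edgeFinset hS
  have hUÊ : U ⊆ dualTopRectEdges n := insideEdges_subset_dualTopRectEdges hS hR
  set ι : ↥S ↪ PBoxV (2 * n) := finsetInclEmb hS with hι
  set A' : Set (BondConfig (PBoxV (2 * n))) := openCrossing (ι '' T) (ι '' A) (ι '' B) with hA'
  have hA'up : IsUpperSet A' := isUpperSet_openCrossing _ _ _
  -- the block's own measure, seen on the primal box with the other vertices isolated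
  have hE : @edgeFinset _ (fromEdgeSet (↑U : Set (Sym2 (PBoxV (2 * n)))))
      (fromEdgeSet (↑U : Set (Sym2 (PBoxV (2 * n))))).fintypeEdgeSet =
      (finsetGraph (zdGraph 2) S).edgeFinset.map ι.sym2Map :=
    @edgeFinset_fromEdgeSet_of_subset _ _ (finsetGraph (zdGraph 2) (pbox (2 * n))) _ U hUE
      (SimpleGraph.fintypeEdgeSet _)
  have step1 : (fkIsingFiniteMeasure S ∅).real (openCrossing T A B) =
      (rcMeasure (fromEdgeSet (↑U : Set (Sym2 (PBoxV (2 * n))))) criticalFKIsingParam 2 ∅).real A' := by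
    rw [fkIsingFiniteMeasure_eq_finsetGraph]
    have h := rcMeasure_real_map_image (G := finsetGraph (zdGraph 2) S)
      (G' := fromEdgeSet (↑U : Set (Sym2 (PBoxV (2 * n))))) ι hE hp two_pos ∅
      (A := (openCrossing T A B : Set (BondConfig ↥(S : Set (Site 2)))))
      (A' := A') fun ω _ ↦ by
        rw [hA', coe_map_sym2Map]; exact (map_image_mem_openCrossing_iff ι _ T A B).symm
    rw [Set.image_empty] at h
    exact h.symm
  -- domination by the ambient free measure
  -- (with the generic `Fintype` instance of the edge set, as inside `rcMeasure`)
  have hEamb : @edgeFinset _ (fromEdgeSet (↑(dualTopRectEdges n) : Set (Sym2 (PBoxV (2 * n)))))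
      (fromEdgeSet (↑(dualTopRectEdges n) : Set (Sym2 (PBoxV (2 * n))))).fintypeEdgeSet =
      dualTopRectEdges n :=
    @edgeFinset_fromEdgeSet_of_subset _ _ (pboxGraph (2 * n)) _ (dualTopRectEdges n)
      (dualTopRectEdges_subset n) (SimpleGraph.fintypeEdgeSet _)
  have hUamb : U ⊆ @edgeFinset _ (fromEdgeSet (↑(dualTopRectEdges n) : Set (Sym2 (PBoxV (2 * n)))))
      (fromEdgeSet (↑(dualTopRectEdges n) : Set (Sym2 (PBoxV (2 * n))))).fintypeEdgeSet := by
    rw [hEamb]; exact hUÊ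
  have h0 : 0 < (rcMeasure (fromEdgeSet (↑(dualTopRectEdges n) : Set (Sym2 (PBoxV (2 * n)))))
      criticalFKIsingParam 2 ∅).real {ω | ω ∩ (↑U : Set (Sym2 (PBoxV (2 * n))))ᶜ = ∅} :=
    rcMeasure_real_pos_of_empty_mem _ hp criticalFKIsingParam_mem_Ioo.2 two_pos ∅
      (by change (∅ : Set (Sym2 (PBoxV (2 * n)))) ∩ (↑U)ᶜ = ∅; exact Set.empty_inter _)
  have step2 := rcMeasure_fromEdgeSet_real_le
    (fromEdgeSet (↑(dualTopRectEdges n) : Set (Sym2 (PBoxV (2 * n))))) hp one_le_two ∅ U hUamb h0 hA'up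
  haveI : IsProbabilityMeasure (rcMeasure (fromEdgeSet (↑(dualTopRectEdges n) :
      Set (Sym2 (PBoxV (2 * n))))) criticalFKIsingParam 2 ∅) := isProbabilityMeasure_rcMeasure _ hp two_pos _
  have step3 : (rcMeasure (fromEdgeSet (↑(dualTopRectEdges n) : Set (Sym2 (PBoxV (2 * n)))))
      criticalFKIsingParam 2 ∅).real {ω | ω ∩ ↑U ∈ A'} ≤
      (rcMeasure (fromEdgeSet (↑(dualTopRectEdges n) : Set (Sym2 (PBoxV (2 * n)))))
        criticalFKIsingParam 2 ∅).real A' :=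
    measureReal_mono (fun ω hω ↦ hA'up Set.inter_subset_left hω) (measure_ne_top _ _)
  exact (le_of_eq step1).trans (step2.trans step3)

end FreeDomination

/-! ### The scale, height and margin; the three blocks -/

section Blocks

/-- The RSW scale `K(n) = ⌊(n-2)/4⌋` of the vertical block. [folklore] -/
def rswScale (n : ℕ) : ℕ := (n - 2) / 4

/-- The height `N(n) = 4 K(n)` of the rectangle `X` (a multiple of `4`). [folklore] -/
def rswHeight (n : ℕ) : ℕ := 4 * rswScale n

/-- The margin `j(n) = n - 2 - N(n) = (n - 2) mod 4`. [folklore] -/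
def rswMargin (n : ℕ) : ℕ := n - 2 - rswHeight n

/-- The arithmetic of the scales for `n ≥ 12`: `K ≥ 1`, `N + 2 + j = n`, `j ≤ 3`, and the glued
blocks fit (`4n ≤ 7N + 1`, so that the right block of width `4n - 1 - 3N` is at least `N` wide and
lies in the right-aligned `4N × N` block). [folklore] -/
theorem rswScale_spec {n : ℕ} (hn : 12 ≤ n) :
    1 ≤ rswScale n ∧ rswHeight n + 2 + rswMargin n = n ∧ rswMargin n ≤ 3 ∧
      4 * n ≤ 7 * rswHeight n + 1 ∧ rswHeight n = 4 * rswScale n := by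
  unfold rswMargin rswHeight rswScale
  omega

end Blocks

/-! ### The long crossing of `X` has probability bounded below under `φ⁰_{⟨Ê⟩}` -/

section Glue

open SimpleGraph Finset

/-- Images under the inclusion of a block into the primal box, then into `ℤ²`: value-defined
vertex sets go to the corresponding subsets of the block. [folklore] -/
theorem image_val_image_finsetInclEmb {n : ℕ} {S : Finset (Site 2)} (hS : S ⊆ pbox (2 * n))
    (P : Site 2 → Prop) :
    (Function.Embedding.subtype _ : PBoxV (2 * n) ↪ Site 2) ''
        (finsetInclEmb hS '' ({x | P x.1} : Set ↥(S : Set (Site 2)))) = {z | z ∈ S ∧ P z} := by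
  ext z
  simp only [Set.mem_image, Set.mem_setOf_eq]
  constructor
  · rintro ⟨_, ⟨x, hx, rfl⟩, rfl⟩
    exact ⟨x.2, hx⟩
  · rintro ⟨hz, hP⟩
    exact ⟨finsetInclEmb hS ⟨z, hz⟩, ⟨⟨z, hz⟩, hP, rfl⟩, rfl⟩

/-- The same for the whole block. [folklore] -/
theorem image_val_image_finsetInclEmb_univ {n : ℕ} {S : Finset (Site 2)} (hS : S ⊆ pbox (2 * n)) :
    (Function.Embedding.subtype _ : PBoxV (2 * n) ↪ Site 2) ''
        (finsetInclEmb hS '' (Set.univ : Set ↥(S : Set (Site 2)))) = ↑S := by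
  ext z
  simp only [Set.mem_image, Set.mem_univ, true_and, Finset.mem_coe]
  constructor
  · rintro ⟨_, ⟨x, rfl⟩, rfl⟩
    exact x.2
  · intro hz
    exact ⟨finsetInclEmb hS ⟨z, hz⟩, ⟨⟨z, hz⟩, rfl⟩, rfl⟩

/-- **The long crossing of `X` is likely under the free measure of `⟨Ê⟩`** (the RSW gluing of
Bollobás–Riordan 2006, Ch. 3, eq. (2), fed with DCS Thm. 3.16 in the three blocks `Q₁`, `Y`,
`Q₂⁺` of `X`, and FKG under `φ⁰_{⟨Ê⟩}`): if `c > 0` bounds from below the free crossing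
probabilities of translated `4m × m` rectangles (horizontally) and `c' > 0` those of translated
`m × 4m` rectangles (vertically) — the two forms of `fkIsing_rsw` of
`RandomClusterIsoInvariance.lean` — then for `n ≥ 12`, with the margin `j(n) = rswMargin n`,
`φ⁰_{⟨Ê⟩}(LR(X)) ≥ c · c' · c`. [cite: BollobasRiordan2006, Ch. 3, eq. (2)] -/
theorem real_primalLongCrossing_ge {c c' : ℝ} (hc : 0 < c) (hc' : 0 < c')
    (h₁ : ∀ m : ℕ, 1 ≤ m → ∀ (v : Site 2) (S' : Finset (Site 2)),
      (∀ x, x ∈ S' ↔ x - v ∈ rectangle (4 * m) m) →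
      c ≤ (fkIsingFiniteMeasure S' ∅).real
        (openCrossing Set.univ {x | x.1 0 = v 0} {x | x.1 0 = v 0 + 4 * m}))
    (h₂ : ∀ m : ℕ, 1 ≤ m → ∀ (v : Site 2) (S' : Finset (Site 2)),
      (∀ x, x ∈ S' ↔ (![x 1 - v 1, x 0 - v 0] : Site 2) ∈ rectangle (4 * m) m) →
      c' ≤ (fkIsingFiniteMeasure S' ∅).real
        (openCrossing Set.univ {x | x.1 1 = v 1} {x | x.1 1 = v 1 + 4 * m}))
    {n : ℕ} (hn : 12 ≤ n) :
    c * c' * c ≤ (rcMeasure (fromEdgeSet (↑(dualTopRectEdges n) : Set (Sym2 (PBoxV (2 * n)))))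
      criticalFKIsingParam 2 ∅).real (primalLongCrossing n (rswMargin n)) := by
  obtain ⟨hK1, hNj, hj3, h7, hNK⟩ := rswScale_spec hn
  set K := rswScale n with hKdef
  set N := rswHeight n with hNdef
  set j := rswMargin n with hjdef
  have hp := criticalFKIsingParam_mem_Icc
  set φD := rcMeasure (fromEdgeSet (↑(dualTopRectEdges n) : Set (Sym2 (PBoxV (2 * n)))))
    criticalFKIsingParam 2 ∅ with hφD
  -- positions
  set v₁ : Site 2 := ![-(2 * n : ℤ) + 1, (n : ℤ) + 1] with hv₁
  set vY : Site 2 := ![-(2 * n : ℤ) + 1 + 3 * N, (n : ℤ) + 1] with hvY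
  set v₂ : Site 2 := ![(2 * n : ℤ) - 4 * N, (n : ℤ) + 1] with hv₂
  have hv₁0 : v₁ 0 = -(2 * n : ℤ) + 1 := rfl
  have hv₁1 : v₁ 1 = (n : ℤ) + 1 := rfl
  have hvY0 : vY 0 = -(2 * n : ℤ) + 1 + 3 * N := rfl
  have hvY1 : vY 1 = (n : ℤ) + 1 := rfl
  have hv₂0 : v₂ 0 = (2 * n : ℤ) - 4 * N := rfl
  have hv₂1 : v₂ 1 = (n : ℤ) + 1 := rfl
  have hglue : vY = v₁ + glueShift (4 * N) N := by
    ext i; fin_cases i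
    · simp [hvY, hv₁, glueShift]; ring
    · simp [hvY, hv₁, glueShift]
  -- the blocks
  set S₁ := rectAt v₁ (4 * N) N with hS₁
  set SY := rectAt vY K (4 * K) with hSY
  set S₂ := rectAt v₂ (4 * N) N with hS₂
  have hNj' : (N : ℤ) + 2 + j = n := by exact_mod_cast hNj
  have hS₁p : S₁ ⊆ pbox (2 * n) := by
    intro x hx; rw [hS₁, mem_rectAt_iff, hv₁0, hv₁1] at hx; rw [mem_pbox]
    intro i; fin_cases i <;> simp <;> push_cast at hx ⊢ <;> omega
  have hSYp : SY ⊆ pbox (2 * n) := by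
    intro x hx; rw [hSY, mem_rectAt_iff, hvY0, hvY1] at hx; rw [mem_pbox]
    intro i; fin_cases i <;> simp <;> push_cast at hx ⊢ <;> omega
  have hS₂p : S₂ ⊆ pbox (2 * n) := by
    intro x hx; rw [hS₂, mem_rectAt_iff, hv₂0, hv₂1] at hx; rw [mem_pbox]
    intro i; fin_cases i <;> simp <;> push_cast at hx ⊢ <;> omega
  have hS₁R : ∀ x ∈ S₁, -(2 * n : ℤ) + 1 ≤ x 0 ∧ x 0 ≤ 2 * n ∧ (n : ℤ) + 1 ≤ x 1 ∧ x 1 ≤ 2 * n := by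
    intro x hx; rw [hS₁, mem_rectAt_iff, hv₁0, hv₁1] at hx; push_cast at hx; omega
  have hSYR : ∀ x ∈ SY, -(2 * n : ℤ) + 1 ≤ x 0 ∧ x 0 ≤ 2 * n ∧ (n : ℤ) + 1 ≤ x 1 ∧ x 1 ≤ 2 * n := by
    intro x hx; rw [hSY, mem_rectAt_iff, hvY0, hvY1] at hx; push_cast at hx; omega
  have hS₂R : ∀ x ∈ S₂, -(2 * n : ℤ) + 1 ≤ x 0 ∧ x 0 ≤ 2 * n ∧ (n : ℤ) + 1 ≤ x 1 ∧ x 1 ≤ 2 * n := by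
    intro x hx; rw [hS₂, mem_rectAt_iff, hv₂0, hv₂1] at hx; push_cast at hx; omega
  set ι₁ := finsetInclEmb hS₁p
  set ιY := finsetInclEmb hSYp
  set ι₂ := finsetInclEmb hS₂p
  -- the three events, on the primal box
  set A₁ : Set (BondConfig (PBoxV (2 * n))) := openCrossing (ι₁ '' (Set.univ : Set ↥(S₁ : Set (Site 2))))
    (ι₁ '' {x : ↥(S₁ : Set (Site 2)) | x.1 0 = v₁ 0}) (ι₁ '' {x : ↥(S₁ : Set (Site 2)) | x.1 0 = v₁ 0 + 4 * N})
    with hA₁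
  set AY : Set (BondConfig (PBoxV (2 * n))) := openCrossing (ιY '' (Set.univ : Set ↥(SY : Set (Site 2))))
    (ιY '' {x : ↥(SY : Set (Site 2)) | x.1 1 = vY 1}) (ιY '' {x : ↥(SY : Set (Site 2)) | x.1 1 = vY 1 + 4 * K})
    with hAY
  set A₂ : Set (BondConfig (PBoxV (2 * n))) := openCrossing (ι₂ '' (Set.univ : Set ↥(S₂ : Set (Site 2))))
    (ι₂ '' {x : ↥(S₂ : Set (Site 2)) | x.1 0 = v₂ 0}) (ι₂ '' {x : ↥(S₂ : Set (Site 2)) | x.1 0 = v₂ 0 + 4 * N})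
    with hA₂
  -- their probabilities
  have hN1 : 1 ≤ N := by omega
  have p₁ : c ≤ φD.real A₁ :=
    (h₁ N hN1 v₁ S₁ fun x ↦ mem_rectAt_iff_sub_mem).trans
      (real_openCrossing_le_free_dualTopRectEdges hS₁p hS₁R _ _ _)
  have pY : c' ≤ φD.real AY :=
    (h₂ K hK1 vY SY fun x ↦ by rw [hSY, mem_rectAt_iff_transpose_mem]).trans
      (real_openCrossing_le_free_dualTopRectEdges hSYp hSYR _ _ _)
  have p₂ : c ≤ φD.real A₂ :=
    (h₁ N hN1 v₂ S₂ fun x ↦ mem_rectAt_iff_sub_mem).trans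
      (real_openCrossing_le_free_dualTopRectEdges hS₂p hS₂R _ _ _)
  -- FKG
  have hup₁ : IsUpperSet A₁ := isUpperSet_openCrossing _ _ _
  have hupY : IsUpperSet AY := isUpperSet_openCrossing _ _ _
  have hup₂ : IsUpperSet A₂ := isUpperSet_openCrossing _ _ _
  have fkg : c * c' * c ≤ φD.real (A₁ ∩ AY ∩ A₂) := by
    have f1 := rcMeasure_fkg_holds (fromEdgeSet (↑(dualTopRectEdges n) : Set (Sym2 (PBoxV (2 * n)))))
      hp one_le_two ∅ hup₁ hupY
    have f2 := rcMeasure_fkg_holds (fromEdgeSet (↑(dualTopRectEdges n) : Set (Sym2 (PBoxV (2 * n)))))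
      hp one_le_two ∅ (hup₁.inter hupY) hup₂
    have e1 : c * c' ≤ φD.real A₁ * φD.real AY := mul_le_mul p₁ pY hc'.le measureReal_nonneg
    have e2 : c * c' * c ≤ φD.real A₁ * φD.real AY * φD.real A₂ :=
      mul_le_mul e1 p₂ hc.le (mul_nonneg measureReal_nonneg measureReal_nonneg)
    have e3 : φD.real A₁ * φD.real AY * φD.real A₂ ≤ φD.real (A₁ ∩ AY) * φD.real A₂ :=
      mul_le_mul_of_nonneg_right f1 measureReal_nonneg
    exact e2.trans (e3.trans f2)
  refine fkg.trans (rcMeasure_real_mono_on_edgeSets _ hp two_pos _ fun ω hωE hω ↦ ?_)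
  -- the gluing, on `ℤ²`
  obtain ⟨⟨hω₁, hωY⟩, hω₂⟩ := hω
  set vP : PBoxV (2 * n) ↪ Site 2 := Function.Embedding.subtype _ with hvP
  have hωsite : Sym2.map vP '' ω ⊆ (zdGraph 2).edgeSet := by
    rintro _ ⟨e, he, rfl⟩
    have he' := hωE he
    rw [edgeSet_fromEdgeSet] at he'
    have heE := dualTopRectEdges_subset n (Finset.mem_coe.1 he'.1)
    induction e using Sym2.ind with
    | h a b =>
      rw [mem_edgeFinset, mem_edgeSet] at heE
      rw [Sym2.map_mk, mem_edgeSet]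
      exact heE
  -- `Q₁`
  have g₁ : Sym2.map vP '' ω ∈ openCrossing ((· + v₁) '' (↑(rectangle (4 * N) N) : Set (Site 2)))
      ((· + v₁) '' ↑(leftSide (4 * N) N)) ((· + v₁) '' ↑(rightSide (4 * N) N)) := by
    have h := (map_image_mem_openCrossing_iff vP ω _ _ _).2 hω₁
    rw [image_val_image_finsetInclEmb_univ, image_val_image_finsetInclEmb hS₁p (fun z ↦ z 0 = v₁ 0),
      image_val_image_finsetInclEmb hS₁p (fun z ↦ z 0 = v₁ 0 + 4 * N)] at h
    refine openCrossing_mono ?_ ?_ ?_ h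
    · intro z hz; rw [Finset.mem_coe, hS₁, mem_rectAt_iff] at hz; rw [mem_image_add_rectangle]; exact hz
    · intro z hz; rw [Set.mem_setOf_eq, hS₁, mem_rectAt_iff] at hz; rw [mem_image_add_leftSide]; exact hz
    · intro z hz; rw [Set.mem_setOf_eq, hS₁, mem_rectAt_iff] at hz; rw [mem_image_add_rightSide]; exact hz
  -- `Y`, crossing the overlap square vertically
  have gY : Sym2.map vP '' ω ∈ openCrossing ((· + (v₁ + glueShift (4 * N) N)) '' (↑(rectangle N N) : Set (Site 2)))
      ((· + (v₁ + glueShift (4 * N) N)) '' ↑(bottomSide N N))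
      ((· + (v₁ + glueShift (4 * N) N)) '' ↑(topSide N N)) := by
    have h := (map_image_mem_openCrossing_iff vP ω _ _ _).2 hωY
    rw [image_val_image_finsetInclEmb_univ, image_val_image_finsetInclEmb hSYp (fun z ↦ z 1 = vY 1),
      image_val_image_finsetInclEmb hSYp (fun z ↦ z 1 = vY 1 + 4 * K)] at h
    rw [← hglue]
    refine openCrossing_mono ?_ ?_ ?_ h
    · intro z hz; rw [Finset.mem_coe, hSY, mem_rectAt_iff] at hz
      rw [mem_image_add_rectangle]; push_cast at hz ⊢; omega
    · intro z hz; rw [Set.mem_setOf_eq, hSY, mem_rectAt_iff] at hz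
      rw [mem_image_add_bottomSide]; push_cast at hz ⊢; omega
    · intro z hz; rw [Set.mem_setOf_eq, hSY, mem_rectAt_iff] at hz
      rw [mem_image_add_topSide]; push_cast at hz ⊢; omega
  -- `Q₂⁺`, then its right part `Q₂`
  have g₂' : Sym2.map vP '' ω ∈ openCrossing ((· + v₂) '' (↑(rectangle (4 * N) N) : Set (Site 2)))
      ((· + v₂) '' ↑(leftSide (4 * N) N)) ((· + v₂) '' ↑(rightSide (4 * N) N)) := by
    have h := (map_image_mem_openCrossing_iff vP ω _ _ _).2 hω₂
    rw [image_val_image_finsetInclEmb_univ, image_val_image_finsetInclEmb hS₂p (fun z ↦ z 0 = v₂ 0),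
      image_val_image_finsetInclEmb hS₂p (fun z ↦ z 0 = v₂ 0 + 4 * N)] at h
    refine openCrossing_mono ?_ ?_ ?_ h
    · intro z hz; rw [Finset.mem_coe, hS₂, mem_rectAt_iff] at hz; rw [mem_image_add_rectangle]; exact hz
    · intro z hz; rw [Set.mem_setOf_eq, hS₂, mem_rectAt_iff] at hz; rw [mem_image_add_leftSide]; exact hz
    · intro z hz; rw [Set.mem_setOf_eq, hS₂, mem_rectAt_iff] at hz; rw [mem_image_add_rightSide]; exact hz
  have hm₂ : (vY 0) + ((4 * n - 1 - 3 * N : ℕ) : ℤ) = v₂ 0 + ((4 * N : ℕ) : ℤ) := by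
    rw [hvY0, hv₂0]; push_cast; omega
  have g₂ := lrCrossingAt_of_right_aligned v₂ (vY 0) (by rw [hvY0, hv₂0]; omega) hm₂ hωsite g₂'
  have hvY' : (![vY 0, v₂ 1] : Site 2) = v₁ + glueShift (4 * N) N := by
    rw [← hglue]; ext i; fin_cases i <;> rfl
  rw [hvY'] at g₂
  -- glue
  have glued := lrCrossingAt_of_glue (m₁ := 4 * N) (m₂ := 4 * n - 1 - 3 * N) (N := N) (by omega)
    (by omega) v₁ hωsite g₁ gY g₂
  have hwidth : 4 * N + (4 * n - 1 - 3 * N) - N = 4 * n - 1 := by omega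
  rw [hwidth] at glued
  -- back to the primal box
  have hcast : ((4 * n - 1 : ℕ) : ℤ) = 4 * n - 1 := by omega
  have key := (map_image_mem_openCrossing_iff' vP ω (primalRect n j)
    ({x : PBoxV (2 * n) | x.1 0 = -(2 * n : ℤ) + 1} ∩ primalRect n j)
    ({x : PBoxV (2 * n) | x.1 0 = 2 * n} ∩ primalRect n j) _ _ _ ?_ ?_ ?_).1
    (openCrossing_subset_inter _ _ _ glued)
  · exact openCrossing_mono le_rfl Set.inter_subset_left Set.inter_subset_left key
  · ext z
    rw [mem_image_add_rectangle, hv₁0, hv₁1, hcast]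
    constructor
    · intro hz
      have hzp : z ∈ pbox (2 * n) := by
        rw [mem_pbox]; intro i; fin_cases i <;> simp <;> omega
      refine ⟨⟨z, hzp⟩, ?_, rfl⟩
      change _ ≤ z 0 ∧ z 0 ≤ _ ∧ _ ≤ z 1 ∧ z 1 ≤ _
      omega
    · rintro ⟨x, hx, rfl⟩
      obtain ⟨h1x, h2x, h3x, h4x⟩ := hx
      change _ ≤ (x.1 0) ∧ x.1 0 ≤ _ ∧ _ ≤ x.1 1 ∧ x.1 1 ≤ _
      omega
  · ext z
    rw [Set.mem_inter_iff, mem_image_add_leftSide, mem_image_add_rectangle, hv₁0, hv₁1, hcast]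
    constructor
    · rintro ⟨⟨hz, hz0⟩, -⟩
      have hzp : z ∈ pbox (2 * n) := by
        rw [mem_pbox]; intro i; fin_cases i <;> simp <;> omega
      refine ⟨⟨z, hzp⟩, ⟨?_, ?_⟩, rfl⟩
      · exact hz0
      · change _ ≤ z 0 ∧ z 0 ≤ _ ∧ _ ≤ z 1 ∧ z 1 ≤ _
        omega
    · rintro ⟨x, ⟨hx0, hx⟩, rfl⟩
      obtain ⟨h1x, h2x, h3x, h4x⟩ := hx
      have hx0' : x.1 0 = -(2 * n : ℤ) + 1 := hx0
      change ((_ ≤ x.1 0 ∧ x.1 0 ≤ _ ∧ _ ≤ x.1 1 ∧ x.1 1 ≤ _) ∧ x.1 0 = _) ∧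
        (_ ≤ x.1 0 ∧ x.1 0 ≤ _ ∧ _ ≤ x.1 1 ∧ x.1 1 ≤ _)
      omega
  · ext z
    rw [Set.mem_inter_iff, mem_image_add_rightSide, mem_image_add_rectangle, hv₁0, hv₁1, hcast]
    constructor
    · rintro ⟨⟨hz, hz0⟩, -⟩
      have hzp : z ∈ pbox (2 * n) := by
        rw [mem_pbox]; intro i; fin_cases i <;> simp <;> omega
      refine ⟨⟨z, hzp⟩, ⟨?_, ?_⟩, rfl⟩
      · change z 0 = 2 * n; omega
      · change _ ≤ z 0 ∧ z 0 ≤ _ ∧ _ ≤ z 1 ∧ z 1 ≤ _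
        omega
    · rintro ⟨x, ⟨hx0, hx⟩, rfl⟩
      obtain ⟨h1x, h2x, h3x, h4x⟩ := hx
      have hx0' : x.1 0 = 2 * n := hx0
      change ((_ ≤ x.1 0 ∧ x.1 0 ≤ _ ∧ _ ≤ x.1 1 ∧ x.1 1 ≤ _) ∧ x.1 0 = _) ∧
        (_ ≤ x.1 0 ∧ x.1 0 ≤ _ ∧ _ ≤ x.1 1 ∧ x.1 1 ≤ _)
      omega

end Glue

/-! ### The conditional reduction: DCS Lemma 6.3 from DCS Theorem 3.16 -/

section Reduction

/-- **DCS Lemma 6.3 from DCS Theorem 3.16** (Duminil-Copin–Smirnov 2012, Lemma 6.3, proof p. 27,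
formalised in full *given* Thm. 3.16): the named fact `fkIsing_rsw` (the RSW-type crossing bound
of Duminil-Copin–Hongler–Nolin 2011 for the critical FK-Ising model with free boundary conditions,
`FKIsingRSW.lean`) implies the named fact `fkIsing_annulusCrossing_le` (circuits in annuli: under
the wired critical FK-Ising measure of `S_{n,2n}` an open inner-to-outer crossing has probability
`≤ c < 1` uniformly in `n`). The chain: `fkIsing_annulusCrossing_le_of_topRect` (annulus → wired
top rectangle, by symmetry, FKG, comparison of boundary conditions and the domain Markov
property), `real_topRectCrossing_le_one_sub_free` (wired rectangle → free primal measure, by the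
planar duality of the box and of rectangles), `real_primalLongCrossing_ge` (RSW gluing of three
instances of Thm. 3.16 under the free measure, by FKG).
[cite: DuminilCopinSmirnov2012Clay, Lemma 6.3] -/
theorem fkIsing_annulusCrossing_le_of_fkIsing_rsw (hrsw : fkIsing_rsw) : fkIsing_annulusCrossing_le := by
  obtain ⟨c, hc, h₁⟩ := fkIsing_rsw.shift hrsw
  obtain ⟨c', hc', h₂⟩ := fkIsing_rsw.transpose_shift hrsw
  have hccc : 0 < c * c' * c := by positivity
  refine fkIsing_annulusCrossing_le_of_topRect (c₁ := 1 - c * c' * c) (by linarith) 12 rswMargin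
    (fun n hn ↦ by have := (rswScale_spec hn).2.1; omega) fun n hn ↦ ?_
  have hj : rswMargin n + 2 ≤ n := by have := (rswScale_spec hn).2.1; omega
  have h := real_topRectCrossing_le_one_sub_free (n := n) (j := rswMargin n) hj
  have h' := real_primalLongCrossing_ge hc hc' h₁ h₂ hn
  linarith

end Reduction

end Literature.Probability.LatticeModels
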